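import Summits.Ventures.GridStability.Lyapunov.NE39LossySplitLinesCast
import Summits.Ventures.GridStability.Lyapunov.NE39LossySplitLinesU7o500SlabCertDataA
import Summits.Ventures.GridStability.Lyapunov.NE39LossySplitLinesU7o500SlabCertDataB
import Literature.Computation.Certificates.PosSemidefDecide
import HarnessLib

/-!
# «NE39-LOSSY-SPLITU-RECORD-TIGHT» — certificate file 1 of 3: the typed certificate data, lit-6's block formulas over `ℚ` and their
# entrywise expansions, the kernel re-decision of the TABLE `L11lit` against the formula, and
# `P − ε·1 ⪰ 0` (19 × 19 kernel `LDLᵀ`; CLASS OF RECORD)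

Cell `gridfusion` (LADDER-GRIDFUSION G2.c lossy Lur'e tier, 39-bus rung); seat gridfusion-lit-6 (g11; g10's generator `probes/ne39/gen_ne39_lean.py` with the record-window TAG patch `probes/rectight/gen_ne39_lean_v2.py`).  See file 3
(`NE39LossySplitLinesU7o500SlabCert.lean`) for the statement of what the three files prove and the three columns; data provenance in
`NE39LossySplitLinesU7o500SlabCertDataA/B.lean` (kit j300200, json sha16 `2cb57f81555fc29f`, results[u0 = 7/500, klass = old]).  Nothing here says a
grid is stable.
[cite: Khalil2002, §7.1.2 Theorem 7.3; Pai1981, §3.6.3 (3.43)–(3.45); HornJohnson2013, Thm 7.7.7]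
-/

noncomputable section

open Real Matrix
open Literature.Computation.Certificates
open Literature.MathematicalPhysics.PowerSystems
open Literature.MathematicalPhysics.PowerSystems.LyapunovFunctionFamily
open Summit.Ventures.GridStability.Models
open Summit.Ventures.GridStability.Bench.WSCC9LossySplitSlab (sector_sin_of_values sector_cos_of_values)
open Summit.Ventures.GridStability.Lyapunov.K2ALossySplitLines (sector_sin_of_values_wide)
open Summit.Ventures.GridStability.Lyapunov.NE39LossySplitLines (e1 AQ CQ BLQ A_eq B_eq C_eq C_mul_B)

namespace Summit.Ventures.GridStability.Lyapunov.NE39LossySplitLinesU7o500SlabCert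

/-! ### The certificate data on the typed indices -/

/-- `P` on the typed state index. -/
def PL₄ : Matrix (Fin 10 ⊕ Fin 9) (Fin 10 ⊕ Fin 9) ℚ := Plq.submatrix e1 e1
/-- `τ` on the typed channel index. -/
def tauL₄ (k : (Fin 10 × Fin 10) ⊕ (Fin 10 × Fin 10)) : ℚ := Sum.elim (fun pq : Fin 10 × Fin 10 => tauTab 0 pq.1 pq.2) (fun pq => tauTab 1 pq.1 pq.2) k
/-- `λ` on the typed channel index. -/
def lamL₄ (k : (Fin 10 × Fin 10) ⊕ (Fin 10 × Fin 10)) : ℚ := Sum.elim (fun pq : Fin 10 × Fin 10 => lamTab 0 pq.1 pq.2) (fun pq => lamTab 1 pq.1 pq.2) k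
/-- `a` on the typed channel index. -/
def aL₄ (k : (Fin 10 × Fin 10) ⊕ (Fin 10 × Fin 10)) : ℚ := Sum.elim (fun pq : Fin 10 × Fin 10 => aTab 0 pq.1 pq.2) (fun pq => aTab 1 pq.1 pq.2) k
/-- `b` on the typed channel index. -/
def bL₄ (k : (Fin 10 × Fin 10) ⊕ (Fin 10 × Fin 10)) : ℚ := Sum.elim (fun pq : Fin 10 × Fin 10 => bTab 0 pq.1 pq.2) (fun pq => bTab 1 pq.1 pq.2) k
/-- The tabulated `L₁₁` on the typed state index. -/
def L11F₄ (i j : Fin 10 ⊕ Fin 9) : ℚ := L11lit (e1 i) (e1 j)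
/-- The tabulated `L₁₂` on the typed indices. -/
def L12F₄ (i : Fin 10 ⊕ Fin 9) (k : (Fin 10 × Fin 10) ⊕ (Fin 10 × Fin 10)) : ℚ :=
  Sum.elim (fun pq : Fin 10 × Fin 10 => L12tab 0 pq.1 pq.2 (e1 i)) (fun pq => L12tab 1 pq.1 pq.2 (e1 i)) k
/-- The tabulated lower matrix on the typed state index. -/
def lowF₄ (i j : Fin 10 ⊕ Fin 9) : ℚ := lowlit (e1 i) (e1 j)

/-! ### Scalar tests (kernel) -/

/-- `τ_k > 0`, `λ_k ≥ 0` and the class-of-record sign rule `λ_k > 0 → a_k ≥ 0` on every channel (kernel). -/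
theorem multL₄ : ∀ k : (Fin 10 × Fin 10) ⊕ (Fin 10 × Fin 10), 0 < tauL₄ k ∧ 0 ≤ lamL₄ k ∧ (0 < lamL₄ k → 0 ≤ aL₄ k) := by
  decide +kernel

/-- `P` is symmetric (kernel). -/
theorem PL_transpose₄ : PL₄ᵀ = PL₄ := by
  decide +kernel

/-! ### The block formulas over `ℚ` (typed) and their entrywise expansions -/

/-- The lower comparison matrix `P + Cᵀ·diag(λa)·C − ε·1` over `ℚ`. -/
def lowerLQ₄ : Matrix (Fin 10 ⊕ Fin 9) (Fin 10 ⊕ Fin 9) ℚ :=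
  PL₄ + CQᵀ * Matrix.diagonal (fun k => lamL₄ k * aL₄ k) * CQ - epsLQ • (1 : Matrix (Fin 10 ⊕ Fin 9) (Fin 10 ⊕ Fin 9) ℚ)

/-- State block `L₁₁` over `ℚ`: `AᵀP + PA + η·1 − Cᵀ·diag(τab)·C`. -/
def LL11Q₄ : Matrix (Fin 10 ⊕ Fin 9) (Fin 10 ⊕ Fin 9) ℚ :=
  AQᵀ * PL₄ + PL₄ * AQ + etaLQ • (1 : Matrix (Fin 10 ⊕ Fin 9) (Fin 10 ⊕ Fin 9) ℚ)
    - CQᵀ * Matrix.diagonal (fun k => tauL₄ k * (aL₄ k * bL₄ k)) * CQ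

/-- Cross block `L₁₂` over `ℚ`: `−PB + (CA)ᵀ·diag(λ) + Cᵀ·diag(τ(a+b)/2)`. -/
def LL12Q₄ : Matrix (Fin 10 ⊕ Fin 9) ((Fin 10 × Fin 10) ⊕ (Fin 10 × Fin 10)) ℚ :=
  -(PL₄ * BLQ) + (CQ * AQ)ᵀ * Matrix.diagonal lamL₄ + CQᵀ * Matrix.diagonal (fun k => tauL₄ k * (aL₄ k + bL₄ k) / 2)

/-- The Schur complement `−L₁₁ − L₁₂·diag(τ)⁻¹·L₁₂ᵀ` over `ℚ` (typed formula). -/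
def SchurQ₄ : Matrix (Fin 10 ⊕ Fin 9) (Fin 10 ⊕ Fin 9) ℚ :=
  -LL11Q₄ - LL12Q₄ * Matrix.diagonal (fun k => (tauL₄ k)⁻¹) * LL12Q₄ᵀ

/-- `(Cᵀ·diag f·C) i j = Σ_k C_ki f_k C_kj` (plumbing). -/
private theorem tDt_apply₄ (f : (Fin 10 × Fin 10) ⊕ (Fin 10 × Fin 10) → ℚ) (i j : Fin 10 ⊕ Fin 9) :
    (CQᵀ * Matrix.diagonal f * CQ) i j = ∑ k, CQ k i * f k * CQ k j := by
  rw [Matrix.mul_apply]; simp only [Matrix.mul_diagonal, Matrix.transpose_apply]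

/-- `(M·diag h·Mᵀ) i j = Σ_k M_ik h_k M_jk` (plumbing). -/
private theorem mDmt_apply₄ (M : Matrix (Fin 10 ⊕ Fin 9) ((Fin 10 × Fin 10) ⊕ (Fin 10 × Fin 10)) ℚ) (h : (Fin 10 × Fin 10) ⊕ (Fin 10 × Fin 10) → ℚ) (i j : Fin 10 ⊕ Fin 9) :
    (M * Matrix.diagonal h * Mᵀ) i j = ∑ k, M i k * h k * M j k := by
  rw [Matrix.mul_apply]; simp only [Matrix.mul_diagonal, Matrix.transpose_apply]

/-- `L₁₁` entrywise (plumbing). -/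
theorem LL11Q_apply₄ (i j : Fin 10 ⊕ Fin 9) : LL11Q₄ i j =
    (∑ l : Fin 10, AQ (Sum.inl l) i * PL₄ (Sum.inl l) j + ∑ l : Fin 9, AQ (Sum.inr l) i * PL₄ (Sum.inr l) j)
      + (∑ l : Fin 10, PL₄ i (Sum.inl l) * AQ (Sum.inl l) j + ∑ l : Fin 9, PL₄ i (Sum.inr l) * AQ (Sum.inr l) j)
      + (if i = j then etaLQ else 0)
      - ((∑ p : Fin 10, ∑ q : Fin 10, CQ (Sum.inl (p, q)) i * (tauL₄ (Sum.inl (p, q)) * (aL₄ (Sum.inl (p, q)) * bL₄ (Sum.inl (p, q)))) * CQ (Sum.inl (p, q)) j)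
        + (∑ p : Fin 10, ∑ q : Fin 10, CQ (Sum.inr (p, q)) i * (tauL₄ (Sum.inr (p, q)) * (aL₄ (Sum.inr (p, q)) * bL₄ (Sum.inr (p, q)))) * CQ (Sum.inr (p, q)) j)) := by
  simp only [LL11Q₄, Matrix.sub_apply, Matrix.add_apply, Matrix.smul_apply, Matrix.one_apply, smul_eq_mul, mul_ite,
    mul_one, mul_zero, tDt_apply₄]
  simp only [Matrix.mul_apply, Matrix.transpose_apply, Fintype.sum_sum_type, Fintype.sum_prod_type]

/-- `L₁₂` entrywise (plumbing). -/
theorem LL12Q_apply₄ (i : Fin 10 ⊕ Fin 9) (k : (Fin 10 × Fin 10) ⊕ (Fin 10 × Fin 10)) : LL12Q₄ i k =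
    -(∑ l : Fin 10, PL₄ i (Sum.inl l) * BLQ (Sum.inl l) k + ∑ l : Fin 9, PL₄ i (Sum.inr l) * BLQ (Sum.inr l) k)
      + (∑ l : Fin 10, CQ k (Sum.inl l) * AQ (Sum.inl l) i + ∑ l : Fin 9, CQ k (Sum.inr l) * AQ (Sum.inr l) i) * lamL₄ k
      + CQ k i * (tauL₄ k * (aL₄ k + bL₄ k) / 2) := by
  simp only [LL12Q₄, Matrix.add_apply, Matrix.neg_apply, Matrix.mul_diagonal, Matrix.transpose_apply]
  simp only [Matrix.mul_apply, Fintype.sum_sum_type]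

/-- The lower matrix entrywise (plumbing). -/
theorem lowerLQ_apply₄ (i j : Fin 10 ⊕ Fin 9) : lowerLQ₄ i j =
    PL₄ i j + ((∑ p : Fin 10, ∑ q : Fin 10, CQ (Sum.inl (p, q)) i * (lamL₄ (Sum.inl (p, q)) * aL₄ (Sum.inl (p, q))) * CQ (Sum.inl (p, q)) j)
        + (∑ p : Fin 10, ∑ q : Fin 10, CQ (Sum.inr (p, q)) i * (lamL₄ (Sum.inr (p, q)) * aL₄ (Sum.inr (p, q))) * CQ (Sum.inr (p, q)) j))
      - (if i = j then epsLQ else 0) := by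
  simp only [lowerLQ₄, Matrix.sub_apply, Matrix.add_apply, Matrix.smul_apply, Matrix.one_apply, smul_eq_mul, mul_ite,
    mul_one, mul_zero, tDt_apply₄]
  simp only [Fintype.sum_sum_type, Fintype.sum_prod_type]

/-- The Schur complement entrywise (plumbing). -/
theorem SchurQ_apply₄ (i j : Fin 10 ⊕ Fin 9) : SchurQ₄ i j =
    -LL11Q₄ i j - ((∑ p : Fin 10, ∑ q : Fin 10, LL12Q₄ i (Sum.inl (p, q)) * (tauL₄ (Sum.inl (p, q)))⁻¹ * LL12Q₄ j (Sum.inl (p, q)))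
        + (∑ p : Fin 10, ∑ q : Fin 10, LL12Q₄ i (Sum.inr (p, q)) * (tauL₄ (Sum.inr (p, q)))⁻¹ * LL12Q₄ j (Sum.inr (p, q)))) := by
  simp only [SchurQ₄, Matrix.sub_apply, Matrix.neg_apply, mDmt_apply₄]
  simp only [Fintype.sum_sum_type, Fintype.sum_prod_type]

/-! ### The tables ARE the blocks (kernel, entrywise over `ℚ`) -/

set_option maxHeartbeats 4000000 in
/-- **`L11lit` is `L₁₁`** entrywise (kernel). -/
theorem L11lit_eq₄ : ∀ i j : Fin 10 ⊕ Fin 9, L11F₄ i j =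
    (∑ l : Fin 10, AQ (Sum.inl l) i * PL₄ (Sum.inl l) j + ∑ l : Fin 9, AQ (Sum.inr l) i * PL₄ (Sum.inr l) j)
      + (∑ l : Fin 10, PL₄ i (Sum.inl l) * AQ (Sum.inl l) j + ∑ l : Fin 9, PL₄ i (Sum.inr l) * AQ (Sum.inr l) j)
      + (if i = j then etaLQ else 0)
      - ((∑ p : Fin 10, ∑ q : Fin 10, CQ (Sum.inl (p, q)) i * (tauL₄ (Sum.inl (p, q)) * (aL₄ (Sum.inl (p, q)) * bL₄ (Sum.inl (p, q)))) * CQ (Sum.inl (p, q)) j)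
        + (∑ p : Fin 10, ∑ q : Fin 10, CQ (Sum.inr (p, q)) i * (tauL₄ (Sum.inr (p, q)) * (aL₄ (Sum.inr (p, q)) * bL₄ (Sum.inr (p, q)))) * CQ (Sum.inr (p, q)) j)) := by
  decide +kernel

/-- `L₁₁ = L11lit` (typed). -/
theorem LL11Q_eq_F₄ (i j : Fin 10 ⊕ Fin 9) : LL11Q₄ i j = L11F₄ i j := by
  rw [LL11Q_apply₄, L11lit_eq₄]

/-- The shifted table `P − ε·1` (what the kernel factorises: the class of record asks `P ⪰ ε·1`). -/
def PShift₄ : Matrix (Fin 19) (Fin 19) ℚ := Plq - epsLQ • (1 : Matrix (Fin 19) (Fin 19) ℚ)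

/-- `PL − ε·1 = PShift` reindexed (typed). -/
theorem PShift_sub₄ : PL₄ - epsLQ • (1 : Matrix (Fin 10 ⊕ Fin 9) (Fin 10 ⊕ Fin 9) ℚ) = PShift₄.submatrix e1 e1 := by
  ext i j
  simp only [PShift₄, PL₄, Matrix.submatrix_apply, Matrix.sub_apply, Matrix.smul_apply, Matrix.one_apply, e1.injective.eq_iff]

/-! ### The two matrix facts (kernel `LDLᵀ`) -/

set_option maxHeartbeats 4000000 in
/-- **`P − ε·1 ⪰ 0`** (19 × 19, kernel `LDLᵀ` on the literal). -/
theorem P_ldl₄ : PSD.LDLCert PShift₄ := by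
  decide +kernel


end Summit.Ventures.GridStability.Lyapunov.NE39LossySplitLinesU7o500SlabCert

end
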